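/-
Copyright (c) 2026 the pub-hodgecm-mathlib formalisation cell (harness21).  Prover seat hodgecm-mathlib-K2Liu-p08 (g5), Track B «K2-LIT»,
#184♮ = hLiu418 = `stmt-HodgeConjecture-24832`; #42S organ S1, (G) organ ROW (ρ-mid), brick (C3-d) «phase dictionary», generic half: THE RAO FORM
`⟨y, c_g y⟩` IS FRAME-INVARIANT (LEAD F0P6-plan (g14) BATCH #64∕#68: (C3) = K2Liu-p26 (g2), (C3-b) p23, (C3-c) K2E1-p10, split evaluation + (C3-d) flag K2Liu-p08).
-/
import Literature.NumberTheory.GelbartRogawski1991.LocalUnitaryFrameTransport                  -- ★ `frameLin`, `frameW`, `frameSp`, `frameMp`, `polar_frameW`, `iota_frameConj`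
import Literature.RepresentationTheory.HeisenbergGroup.SymplecticMatrixTransportUnipotentRadical -- ★ `cOfFix`, `dotProduct_cOfFix_mulVec_self_eq_alt`
import Literature.RepresentationTheory.HeisenbergGroup.SchrodingerPiOperators                    -- ★ `halfForm`
import HarnessLib

/-!
# Crux `HLiu418`, #42S organ S1, (ρ-mid) brick (C3-d), generic half: THE RAO FORM `⟨y, c_g y⟩` IS INVARIANT UNDER A RATIONAL FRAME

Cell `hodgecm-mathlib`, crux item hLiu418 = `stmt-HodgeConjecture-24832`; squad K2 ∕ K2Liu; LEAD F0P6-plan (g14); prover K2Liu-p08 (g5).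
THEOREMS ONLY (no `def`, no instance, no notation, no named-fact hypothesis, no `sorry`); lane `--supports stmt-HodgeConjecture-24832 --as helper`.

WHY.  The (C3) Levi-row head of the (M2a) middle-profile chain (K2Liu-p26 (g2) `K2LiuTensorMiddleCellLeviRow`, head bytes 2026-09-04T22:15:07Z) carries the
phase of ★ (C2b′) `K2LiuTensorMiddleCellHaarDelta.exists_ne_zero_swSectionTensorLoc_flip_mul_nElem_eq_integral_frameMp` VERBATIM:
`ψ_v(−halfForm (mulVecLin c_{tb}) (glue x₁ 0))` with `c_{tb} = cOfFix 𝕋_fin (π(j̃) ι_fin(n(tb)) π(j̃)⁻¹)` on the BLOCK model `𝕎_{T₁ ⊕ᶠ T₂}`.  The three evaluation hands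
(inert ★ `factorisation_of_middleProfile_balls`, ramified F0P2-p07, split ★ `splitMiddleRows_of_balls`) all need the phase as an additive character applied to the
hermitian Gram of the frame coordinates, and the dictionary for THAT is ★ only in the TENSOR currency — ★ (T3a) `dotProduct_cOfFix_tensorEmbLoc_nElem_eq_im_trace`
(`⟨x, c_t x⟩ = im_Q(2·tr(𝕋₀ t G̃(x)))` at an implementer `E′` of the tensor datum, `G̃` the Gram of `halfDiff(e_D⁻¹(E′⁻¹(x,0)))`) + ★ (Φ4) `toLocalRing_d_mul_half_pairing`.
THIS FILE is the bridge from the block currency to the tensor currency: along a rational frame `P` with `Pᵀ T P = T′` (★ `FrameTransport`: `frameLin P : y ↦ P y`,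
`frameW = frameLin × frameLin` a symplectic isomorphism `𝕎_{T′} ≃ 𝕎_T`, `frameSp g = frameW g frameW⁻¹`, `π(frameMp m) = frameSp (π m)`):
* §1 **`dotProduct_cOfFix_frameSp`**: `⟨P y, c_T(frameSp g) · P y′⟩ = ⟨y, c_{T′}(g) y′⟩` — the Rao second-degree form is intrinsic (★ `dotProduct_cOfFix_mulVec_self_eq_alt`:
  `⟨x, c_g x′⟩ = A((x,0), g(x′,0))`) and `frameW` is an isometry of `A` (★ `polar_frameW`); hence `halfForm_cOfFix_frameSp` for Rao's `halfForm`;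
* §2 **`halfForm_cOfFix_frameSp_conj`**: the same for the conjugates `frameSp g₀ · frameSp h · (frameSp g₀)⁻¹` (`g₀ = π(m)`: `π(frameMp m) = frameSp (π m)` is ★ `proj_frameMp`,
  `rfl`), and **`halfForm_cOfFix_frameSp_conj_iota`** for `h = ι_{T′}(g′)`, read on the `T`-side as `ι_T(frameConj g′)` (★ `iota_frameConj`).
CONSUMER ((C3-d) proper, the (M2a) chain at `N := (M₂+M₂)+(M₂+M₂)`, `P := PD`, `m := j̃(p₁,p₂)`, `g′ := n_fin(tb)`): with ★ `frameConj_nElem` (`frameConj (n_fin(tb)) =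
n(reindex (t ⊗ₖ 1))` under the (M1) letter `hPX`) and ★ `tensorEmbLoc_nElem`, the (C3) phase `halfForm (mulVecLin c_{tb}) y` IS `halfForm (mulVecLin (cOfFix 𝕋′
(E′_ε ι(n(t) ⊗ 1) E′_ε⁻¹))) (frameLin PD y)` with `E′_ε = π(frameMp_{PD} j̃)`, to which ★ (T3a) applies.
References: [Rangarao1993] Lemma 3.2 (3.8) p. 351; [Weil1964] n° 5–6 pp. 150–151, n° 34; [MoeglinVignerasWaldspurger1987] Chap. 2 II Remarque (3); [Kudla1994] §3 Thm. 3.1.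
HONEST LABEL.  Count-neutral helper: `HC_CM` is proved only modulo the 7 printed citations (2 remaining named inputs: hLiu418 = `stmt-HodgeConjecture-24832`,
h413 = `stmt-HodgeConjecture-24833`) until rung 0 closes.

## References
* [Rangarao1993] R. Ranga Rao, *On some explicit formulas in the theory of Weil representation*, Pacific J. Math. 157 (1993), Lemma 3.2 (3.8), p. 351.
* [Weil1964] A. Weil, *Sur certains groupes d'opérateurs unitaires*, Acta Math. 111 (1964), n° 5–6, n° 34.
* [MoeglinVignerasWaldspurger1987] C. Mœglin, M.-F. Vignéras, J.-L. Waldspurger, LNM 1291 (1987), Chap. 2 II Remarque (3).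
* [Kudla1994] S. S. Kudla, Israel J. Math. 87 (1994), §3 Thm. 3.1.
-/

set_option autoImplicit false
set_option linter.dupNamespace false -- the mandated namespace repeats `HodgeConjecture.HodgeConjecture`

noncomputable section

open NumberField IsDedekindDomain Matrix
open Literature.RepresentationTheory.HeisenbergGroup Literature.RepresentationTheory.HeisenbergGroup.SymplecticMatrix
open Literature.NumberTheory.Automorphic
open Literature.NumberTheory.GelbartRogawski1991 Literature.NumberTheory.GelbartRogawski1991.UnitaryDualPair
open Literature.NumberTheory.GelbartRogawski1991.UnitaryDualPair.LocalSplitting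
open Literature.NumberTheory.GelbartRogawski1991.UnitaryDualPair.LocalSplitting.FrameTransport

namespace Summit.HodgeConjecture.HodgeConjecture.Cruxes.HLiu418.K2LiuRaoFormFrameTransport

variable (F : Type) [Field F] [NumberField F] (v : HeightOneSpectrum (𝓞 F)) (N : ℕ) {T T' : Matrix (Fin N) (Fin N) F}
  (P : GL (Fin N) F) (hP : (P : Matrix (Fin N) (Fin N) F)ᵀ * T * (P : Matrix (Fin N) (Fin N) F) = T')

/-! ## §1 The Rao form `⟨y, c_g y′⟩` is frame-invariant -/

/-- **FRAME INVARIANCE OF THE RAO FORM**: `⟨P y, c_T(frameSp g) (P y′)⟩ = ⟨y, c_{T′}(g) y′⟩` for every `g ∈ Sp(𝕎_{T′})` — `⟨x, c_g x′⟩ = A((x,0), g(x′,0))`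
(★ `dotProduct_cOfFix_mulVec_self_eq_alt`), `(P y, 0) = frameW (y, 0)`, `frameSp g = frameW ∘ g ∘ frameW⁻¹`, and `frameW` preserves `A` (★ `polar_frameW`).
[cite: Rangarao1993, Lemma 3.2 (3.8), p. 351] [cite: Weil1964, n° 34] -/
theorem dotProduct_cOfFix_frameSp (g : LocalSp F N T' v) (y y' : Fin N → v.adicCompletion F) :
    frameLin F v N P y ⬝ᵥ cOfFix (localGram F N T v) (frameSp F v N P hP g) *ᵥ frameLin F v N P y' =
      y ⬝ᵥ cOfFix (localGram F N T' v) g *ᵥ y' := by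
  rw [dotProduct_cOfFix_mulVec_self_eq_alt, dotProduct_cOfFix_mulVec_self_eq_alt]
  change alt (polar (localPairing F N T v)) (frameLin F v N P y, 0)
      (((frameSp F v N P hP g : LocalSp F N T v) :
        ((Fin N → v.adicCompletion F) × (Fin N → v.adicCompletion F)) ≃ₗ[v.adicCompletion F]
          ((Fin N → v.adicCompletion F) × (Fin N → v.adicCompletion F))) (frameLin F v N P y', 0)) =
    alt (polar (localPairing F N T' v)) (y, 0)
      (((g : LocalSp F N T' v) :
        ((Fin N → v.adicCompletion F) × (Fin N → v.adicCompletion F)) ≃ₗ[v.adicCompletion F]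
          ((Fin N → v.adicCompletion F) × (Fin N → v.adicCompletion F))) (y', 0))
  have h0 : ((frameLin F v N P y, (0 : Fin N → v.adicCompletion F)) :
      (Fin N → v.adicCompletion F) × (Fin N → v.adicCompletion F)) = frameW F v N P (y, 0) := by
    rw [frameW_apply, map_zero]
  have h0' : ((frameLin F v N P y', (0 : Fin N → v.adicCompletion F)) :
      (Fin N → v.adicCompletion F) × (Fin N → v.adicCompletion F)) = frameW F v N P (y', 0) := by
    rw [frameW_apply, map_zero]
  have happly : (((frameSp F v N P hP g : LocalSp F N T v) :
        ((Fin N → v.adicCompletion F) × (Fin N → v.adicCompletion F)) ≃ₗ[v.adicCompletion F]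
          ((Fin N → v.adicCompletion F) × (Fin N → v.adicCompletion F))) (frameW F v N P (y', 0))) =
      frameW F v N P (((g : LocalSp F N T' v) :
        ((Fin N → v.adicCompletion F) × (Fin N → v.adicCompletion F)) ≃ₗ[v.adicCompletion F]
          ((Fin N → v.adicCompletion F) × (Fin N → v.adicCompletion F))) (y', 0)) := by
    show frameW F v N P (((g : LocalSp F N T' v) :
        ((Fin N → v.adicCompletion F) × (Fin N → v.adicCompletion F)) ≃ₗ[v.adicCompletion F]
          ((Fin N → v.adicCompletion F) × (Fin N → v.adicCompletion F))) ((frameW F v N P).symm (frameW F v N P (y', 0)))) = _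
    rw [LinearEquiv.symm_apply_apply]
  rw [h0, h0', happly, alt_apply, alt_apply, polar_frameW F v N P hP, polar_frameW F v N P hP]

/-- **FRAME INVARIANCE OF RAO'S `halfForm`**: `½⟨P y, c_T(frameSp g) (P y)⟩ = ½⟨y, c_{T′}(g) y⟩`. [cite: Rangarao1993, Lemma 3.2 (3.8), p. 351] [cite: Weil1964, n° 34] -/
theorem halfForm_cOfFix_frameSp (g : LocalSp F N T' v) (y : Fin N → v.adicCompletion F) :
    halfForm (Matrix.mulVecLin (cOfFix (localGram F N T v) (frameSp F v N P hP g))) (frameLin F v N P y) =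
      halfForm (Matrix.mulVecLin (cOfFix (localGram F N T' v) g)) y := by
  rw [halfForm_apply, halfForm_apply, Matrix.mulVecLin_apply, Matrix.mulVecLin_apply, dotProduct_cOfFix_frameSp F v N P hP]

/-! ## §2 Conjugates `g₀ h g₀⁻¹` through the frame (the (C3) phase has `g₀ = π(j̃)`, `h = ι(n(tb))`) -/

/-- **THE RAO FORM OF A FRAME-TRANSPORTED CONJUGATE**: `⟨P y, c_T(frameSp g₀ · frameSp h · (frameSp g₀)⁻¹) (P y′)⟩ = ⟨y, c_{T′}(g₀ h g₀⁻¹) y′⟩`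
(`frameSp` is multiplicative).  With `g₀ := π(m)` this is the (C3) phase: `π(frameMp m) = frameSp (π m)` is ★ `proj_frameMp` (`rfl`), so the consumer rewrites
`MpPsi.proj _ (frameMp … m)` into `frameSp … (MpPsi.proj _ m)` first. [cite: MoeglinVignerasWaldspurger1987, Chap. 2 II Remarque (3)] [cite: Rangarao1993, Lemma 3.2 (3.8), p. 351] -/
theorem dotProduct_cOfFix_frameSp_conj (g₀ h : LocalSp F N T' v) (y y' : Fin N → v.adicCompletion F) :
    frameLin F v N P y ⬝ᵥ cOfFix (localGram F N T v)
        (frameSp F v N P hP g₀ * frameSp F v N P hP h * (frameSp F v N P hP g₀)⁻¹) *ᵥ frameLin F v N P y' =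
      y ⬝ᵥ cOfFix (localGram F N T' v) (g₀ * h * g₀⁻¹) *ᵥ y' := by
  have hconj : frameSp F v N P hP g₀ * frameSp F v N P hP h * (frameSp F v N P hP g₀)⁻¹ = frameSp F v N P hP (g₀ * h * g₀⁻¹) := by
    rw [map_mul, map_mul, map_inv]
  rw [hconj]
  exact dotProduct_cOfFix_frameSp F v N P hP (g₀ * h * g₀⁻¹) y y'

/-- `halfForm` version of `dotProduct_cOfFix_frameSp_conj`. [cite: MoeglinVignerasWaldspurger1987, Chap. 2 II Remarque (3)] [cite: Rangarao1993, Lemma 3.2 (3.8), p. 351] -/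
theorem halfForm_cOfFix_frameSp_conj (g₀ h : LocalSp F N T' v) (y : Fin N → v.adicCompletion F) :
    halfForm (Matrix.mulVecLin (cOfFix (localGram F N T v)
        (frameSp F v N P hP g₀ * frameSp F v N P hP h * (frameSp F v N P hP g₀)⁻¹))) (frameLin F v N P y) =
      halfForm (Matrix.mulVecLin (cOfFix (localGram F N T' v) (g₀ * h * g₀⁻¹))) y := by
  rw [halfForm_apply, halfForm_apply, Matrix.mulVecLin_apply, Matrix.mulVecLin_apply, dotProduct_cOfFix_frameSp_conj F v N P hP]

section Unitary

variable (E : Type) [Field E] [NumberField E] [Algebra F E] [Algebra.IsQuadraticExtension F E] (c : E ≃ₐ[F] E)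
  {δ : E} (hcδ : c δ = -δ) (hδ : δ ≠ 0) {d : F} (hd : δ * δ = algebraMap F E d)
  {J : Matrix (Fin N) (Fin N) E} (hJ : J = T.map (algebraMap F E)) {J' : Matrix (Fin N) (Fin N) E} (hJ' : J' = T'.map (algebraMap F E))
  (hT : T.IsSymm) (hT' : T'.IsSymm)

/-- **THE RAO FORM OF `frameSp g₀ · ι_T(frameConj g′) · (frameSp g₀)⁻¹`** at `P y` equals the Rao form of `g₀ · ι_{T′}(g′) · g₀⁻¹` at `y` — the unitary element is
moved through the frame by ★ `iota_frameConj` (`ι_T(P g′ P⁻¹) = frameSp (ι_{T′} g′)`).  The (C3-d) consumer takes `g₀ := π(j̃(p₁,p₂))` (★ `proj_frameMp`), `g′ := n_fin(tb)`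
(then ★ `frameConj_nElem` + ★ `tensorEmbLoc_nElem` name `frameConj g′` as `n(t) ⊗ 1`). [cite: MoeglinVignerasWaldspurger1987, Chap. 2 II Remarque (3)] [cite: Kudla1994, §3 Thm. 3.1] -/
theorem dotProduct_cOfFix_frameSp_conj_iota (g₀ : LocalSp F N T' v) (g' : UnitaryGroup.localPi E c N J' v) (y y' : Fin N → v.adicCompletion F) :
    frameLin F v N P y ⬝ᵥ cOfFix (localGram F N T v)
        (frameSp F v N P hP g₀ * iota F E c N hcδ hδ hd T hT hJ v (frameConj F E c v N hJ hJ' P hP g') * (frameSp F v N P hP g₀)⁻¹) *ᵥ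
          frameLin F v N P y' =
      y ⬝ᵥ cOfFix (localGram F N T' v) (g₀ * iota F E c N hcδ hδ hd T' hT' hJ' v g' * g₀⁻¹) *ᵥ y' := by
  rw [iota_frameConj F E c v N hJ hJ' P hP hcδ hδ hd hT hT']
  exact dotProduct_cOfFix_frameSp_conj F v N P hP g₀ _ y y'

/-- `halfForm` version of `dotProduct_cOfFix_frameSp_conj_iota` — the shape of the (C3) head's phase `ψ_v(−halfForm (mulVecLin c_{tb}) y)`.
[cite: MoeglinVignerasWaldspurger1987, Chap. 2 II Remarque (3)] [cite: Kudla1994, §3 Thm. 3.1] [cite: Rangarao1993, Lemma 3.2 (3.8), p. 351] -/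
theorem halfForm_cOfFix_frameSp_conj_iota (g₀ : LocalSp F N T' v) (g' : UnitaryGroup.localPi E c N J' v) (y : Fin N → v.adicCompletion F) :
    halfForm (Matrix.mulVecLin (cOfFix (localGram F N T v)
        (frameSp F v N P hP g₀ * iota F E c N hcδ hδ hd T hT hJ v (frameConj F E c v N hJ hJ' P hP g') * (frameSp F v N P hP g₀)⁻¹)))
          (frameLin F v N P y) =
      halfForm (Matrix.mulVecLin (cOfFix (localGram F N T' v) (g₀ * iota F E c N hcδ hδ hd T' hT' hJ' v g' * g₀⁻¹))) y := by
  rw [halfForm_apply, halfForm_apply, Matrix.mulVecLin_apply, Matrix.mulVecLin_apply,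
    dotProduct_cOfFix_frameSp_conj_iota F v N P hP E c hcδ hδ hd hJ hJ' hT hT']

end Unitary

end Summit.HodgeConjecture.HodgeConjecture.Cruxes.HLiu418.K2LiuRaoFormFrameTransport

end
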